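import Summits.BirchSwinnertonDyer.Rank1Residual.Additive.SignatureDichotomyThreeHolds
import Summits.BirchSwinnertonDyer.Rank1Residual.Additive.LocalThreeTorsionIffTamagawaThreeOfIVHolds
import Summits.BirchSwinnertonDyer.Rank1Residual.Additive.WildThreeKrausCells
import Summits.BirchSwinnertonDyer.Rank1Residual.Additive.PotSupersingularClasses
import Literature.NumberTheory.DiophantineGeometry.ConductorExponentLeFiveProofs
import Literature.NumberTheory.EllipticCurves.NeronComponentIndexProofs
import HarnessLib

/-!
# The Tate-algorithm dictionary at `3` on the principal-series / cyclic wild rows of route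
# `CyclotomicUntwist`: `f₃ = 4 ⟺ v₃(Δ_min)` even, the Kodaira type by `v₃(Δ_min) mod 4`, the local
# Tamagawa number `c₃`, and the failure of the Fouquet–Wan local hypothesis (L3) — UNCONDITIONALLY

Cell `pub/bsd-wall` (D-0145 line `route-BirchSwinnertonDyer-CyclotomicUntwist`), seat `bsd-line-cycu-p4`
(width seat 4, gen 2), helper toward the cruxes K1 `PSRankOneLowerHalfAtThree`
(stmt-BirchSwinnertonDyer-21580) and K2 `PSRankOneUpperHalfAtThree` (stmt-BirchSwinnertonDyer-21581).
THEOREMS ONLY (no definition, no named fact, no `sorry`, no instance); BSD is not proved by this file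
and no crux is. Route-free (no `Theses` import): every statement is about a globally minimal `E/ℚ` on
the WILD CELL at `3` (`Addv W 3 ∧ SubW W 3` = class O6: additive, `ord₃ j ≥ 0`, `f₃ ≠ 2`), on which the
route's principal-series rows are cut out by `v₃(Δ_min)` even (and `Δ_min/3^v ≡ 1 (mod 3)`, unused here).

## What is proved (all `W/ℚ` elliptic, globally minimal; `v := v₃(Δ_min)`, `K₃ := W.kodairaSymbolAt (placeOf 3)`,
## `c₃ := (W ⊗ ℚ₃).localTamagawaNumber ℤ₃`, `f₃ := condExp W 3`)

* §1 `wild_bounds`: on the wild cell `K₃ ∈ {II, IV, IV*, II*}`, `m + 2 ≤ v ≤ m + 4` and `f₃ + m = v + 1`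
  (`m` = number of components) — the tree's lower bound
  `numComponents_add_two_le_ordMinimalDiscriminant_three_of_kodairaSymbolAt_wild` (Tate's normal forms) and
  upper bound `conductorExponent_le_five_of_natGenerator_eq_three_holds` (`f₃ ≤ 5`, Ogg–Saito / ATAEC IV.10.4,
  proved in the tree branch by branch), with Ogg's formula as the DEFINITION of `f₃`. Hence the
  Papadopoulos windows `II: v ∈ [3,5]`, `IV: [5,7]`, `IV*: [9,11]`, `II*: [11,13]` (`kodairaSymbolAt_windows`).
* §2 **`condExp_eq_four_iff_even`: `f₃ = 4 ↔ v` even** (`m` is odd on the four wild types, so `f₃ ≡ v (mod 2)`,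
  and `f₃ ∈ {3,4,5}`); equivalently **`condExp_eq_four_iff_subWCyclic`: `f₃ = 4 ↔ SubWCyclic W`** and
  `condExp_eq_three_or_five_iff_subWDicyclic` — the UNCONDITIONAL form of the E2 dictionary
  `O6Targets.condExp_eq_four_iff_subWCyclic` (there granted an `AdmissibleWildTyping`; census 16 982 / 16 982),
  and **`kodairaSymbolAt_of_even`: `v` even ⟹ `(v, K₃) ∈ {(4, II), (6, IV), (10, IV*), (12, II*)}`**, refined by
  `v mod 4`: `4 ∣ v ⟹ II (v = 4) ∨ II* (v = 12)` (the route's `η` of order `3`), `v ≡ 2 (4) ⟹ IV (6) ∨ IV* (10)`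
  (`η` of order `6`); `krausInertiaOrderThree_of_even` (`#Φ = 3` resp. `6`).
* §3 **Tamagawa at `3`**: `4 ∣ v ⟹ c₃ = 1` (`localTamagawaNumber_three_eq_one_of_four_dvd`, Tate Steps 3/10:
  `c = 1` for II/II*, tree facts `…_eq_II(_star)_holds`); `v` even ⟹ `c₃ ∈ {1, 3}`
  (`localTamagawaNumber_three_of_even`, Steps 5/8 for IV/IV*), so `ord₃ c₃ ≤ 1`, and
  `3 ∣ c₃ ⟹ v ≡ 2 (mod 4) ∧ K₃ ∈ {IV, IV*}` (`mod_four_eq_two_of_three_dvd_localTamagawaNumber`): K2's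
  "why it might fail" clause «`c₃ = 3` occurs on IV/IV* rows» is CONFINED to the `η`-order-`6` rows; on the
  `η`-order-`3` rows (`v ∈ {4, 12}`; census 72 of the 416 PS classes, K1-NEAREST-PRINT-v2 §0) `c₃ = 1`.
* §4 **(L3) fails on every cyclic wild row**: `not_locIrr_three_of_subWCyclic : Addv W 3 → SubWCyclic W → ¬ LocIrr W 3`
  — o6-r1's wanted implication behind the census `LocIrr(3) = 0 / 5 161`
  (`Additive/LocIrrThreeCriteria.lean` §3, where `f₃ = 4` and the `v`-values were HYPOTHESES), now a theorem:
  §2 feeds `not_locIrr_three_of_condExp_eq_four`. So `E[3]|G_{ℚ₃}` is reducible on EVERY principal-series row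
  and Fouquet–Wan 2021 Thm 1.7 (hypothesis: `ρ̄|G_{ℚ_p}` not of the shape `χ̄ ⊕ χ̄ω`) is inapplicable there — as a
  theorem `∀ W`, upgrading the 416-row census certificate p592222 cited in the K1/K2 retriage texts.
* §5 the same facts in the binder shape of the route's PS rows (`ClassO6 W 3`, `v` even): `psRow_facts`.

References: J. H. Silverman, *Advanced Topics in the Arithmetic of Elliptic Curves*, GTM 151 (1994), IV.9.4
(Tate's algorithm, Steps 3, 5, 8, 10), Table 4.1, IV.10.4, IV.11.1 [SilvermanATAEC1994]; I. Papadopoulos,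
J. Number Theory 44 (1993) Table (p = 3) [Papadopoulos1993]; A. Kraus, Manuscripta Math. 69 (1990)
[Kraus1990]; O. Fouquet, X. Wan, arXiv:2107.13726, Thm 1.7 [FouquetWan2021].
-/

noncomputable section

open scoped Classical

open WeierstrassCurve IsDedekindDomain Rat.HeightOneSpectrum Literature.NumberTheory.EllipticCurves
  Literature.NumberTheory.EllipticCurves.Rank1Residual Literature.NumberTheory.DiophantineGeometry
  Summit.BirchSwinnertonDyer.Rank1Residual.Additive

-- single-conjunct summit: `Summit.BirchSwinnertonDyer.BirchSwinnertonDyer.…` repeats the name by design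
set_option linter.dupNamespace false
set_option autoImplicit false

namespace Summit.BirchSwinnertonDyer.BirchSwinnertonDyer.Theorems.PSKodairaDictionary

variable (W : WeierstrassCurve ℚ) [W.IsElliptic] [W.IsGloballyMinimal]

/-! ### §1 The wild cell at `3`: bounds `m + 2 ≤ v₃(Δ_min) ≤ m + 4` and Ogg's formula -/

/-- The rational prime below `placeOf 3` is `3`. [folklore] -/
private theorem natGenerator_placeOf_three : natGenerator (placeOf 3) = 3 :=
  Literature.NumberTheory.EllipticCurves.Rat.natGenerator_primesEquiv_symm ⟨3, Nat.prime_three⟩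

/-- Ogg's formula at `3` as the tree's DEFINITION of `f₃`, in `ℕ` without truncation-prone subtraction:
`f₃ + m = v₃(Δ_min) + 1` as soon as `m ≤ v₃(Δ_min) + 1`. [cite: SilvermanATAEC1994, IV.11.1] -/
theorem condExp_add_numComponents_eq
    (hm : (W.kodairaSymbolAt (placeOf 3)).numComponents ≤ padicValInt 3 W.minimalDiscriminantInt + 1) :
    condExp W 3 + (W.kodairaSymbolAt (placeOf 3)).numComponents =
      padicValInt 3 W.minimalDiscriminantInt + 1 := by
  unfold condExp WeierstrassCurve.conductorExponent WeierstrassCurve.numComponentsAt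
  rw [ordMinimalDiscriminant_placeOf_eq W 3]
  omega

omit [W.IsGloballyMinimal] in
/-- **`f₃ ≤ 5`** in the census currency `condExp W 3` (the tree theorem
`conductorExponent_le_five_of_natGenerator_eq_three_holds`, ATAEC IV.10.4). [cite: SilvermanATAEC1994, IV.10.4] -/
theorem condExp_three_le_five : condExp W 3 ≤ 5 :=
  W.conductorExponent_le_five_of_natGenerator_eq_three_holds (placeOf 3) natGenerator_placeOf_three

/-- **The wild cell at `3`, bounds.** For `W` additive at `3` in the cell (w) (`SubW W 3`): the Kodaira type is
one of `II, IV, IV*, II*`, `m + 2 ≤ v₃(Δ_min) ≤ m + 4`, and `f₃ + m = v₃(Δ_min) + 1`.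
[cite: SilvermanATAEC1994, IV.9.4, Table 4.1 and IV.10.4] -/
theorem wild_bounds (hadd : Addv W 3) (hW : SubW W 3) :
    (W.kodairaSymbolAt (placeOf 3) = .II ∨ W.kodairaSymbolAt (placeOf 3) = .IV ∨
      W.kodairaSymbolAt (placeOf 3) = .IVstar ∨ W.kodairaSymbolAt (placeOf 3) = .IIstar) ∧
    (W.kodairaSymbolAt (placeOf 3)).numComponents + 2 ≤ padicValInt 3 W.minimalDiscriminantInt ∧
    padicValInt 3 W.minimalDiscriminantInt ≤ (W.kodairaSymbolAt (placeOf 3)).numComponents + 4 ∧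
    condExp W 3 + (W.kodairaSymbolAt (placeOf 3)).numComponents =
      padicValInt 3 W.minimalDiscriminantInt + 1 := by
  have hT := (subW_three_iff_kodairaSymbolAt_wild W hadd).mp hW
  have hlow := numComponents_add_two_le_ordMinimalDiscriminant_three_of_kodairaSymbolAt_wild W hT
  rw [ordMinimalDiscriminant_placeOf_eq W 3] at hlow
  have hOgg := condExp_add_numComponents_eq W (by omega)
  have h5 := condExp_three_le_five W
  exact ⟨hT, hlow, by omega, hOgg⟩

/-- **The Papadopoulos windows at `3`** on the wild cell: `II` with `v₃(Δ_min) ∈ [3, 5]`, `IV` with `[5, 7]`,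
`IV*` with `[9, 11]`, `II*` with `[11, 13]`, and in each case `f₃ = v₃(Δ_min) + 1 − m`.
[cite: Papadopoulos1993, Table (p = 3)] [cite: SilvermanATAEC1994, Table 4.1] -/
theorem kodairaSymbolAt_windows (hadd : Addv W 3) (hW : SubW W 3) :
    (W.kodairaSymbolAt (placeOf 3) = .II ∧ 3 ≤ padicValInt 3 W.minimalDiscriminantInt ∧
        padicValInt 3 W.minimalDiscriminantInt ≤ 5 ∧ condExp W 3 = padicValInt 3 W.minimalDiscriminantInt) ∨
      (W.kodairaSymbolAt (placeOf 3) = .IV ∧ 5 ≤ padicValInt 3 W.minimalDiscriminantInt ∧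
        padicValInt 3 W.minimalDiscriminantInt ≤ 7 ∧ condExp W 3 + 2 = padicValInt 3 W.minimalDiscriminantInt) ∨
      (W.kodairaSymbolAt (placeOf 3) = .IVstar ∧ 9 ≤ padicValInt 3 W.minimalDiscriminantInt ∧
        padicValInt 3 W.minimalDiscriminantInt ≤ 11 ∧ condExp W 3 + 6 = padicValInt 3 W.minimalDiscriminantInt) ∨
      (W.kodairaSymbolAt (placeOf 3) = .IIstar ∧ 11 ≤ padicValInt 3 W.minimalDiscriminantInt ∧
        padicValInt 3 W.minimalDiscriminantInt ≤ 13 ∧ condExp W 3 + 8 = padicValInt 3 W.minimalDiscriminantInt) := by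
  obtain ⟨hT, hlow, hup, hOgg⟩ := wild_bounds W hadd hW
  rcases hT with hK | hK | hK | hK <;> rw [hK] at hlow hup hOgg <;>
    simp only [KodairaSymbol.numComponents] at hlow hup hOgg
  · exact Or.inl ⟨hK, by omega, by omega, by omega⟩
  · exact Or.inr (Or.inl ⟨hK, by omega, by omega, by omega⟩)
  · exact Or.inr (Or.inr (Or.inl ⟨hK, by omega, by omega, by omega⟩))
  · exact Or.inr (Or.inr (Or.inr ⟨hK, by omega, by omega, by omega⟩))

/-! ### §2 `f₃ = 4 ⟺ v₃(Δ_min)` even ⟺ the cyclic Kraus cell; the Kodaira type by `v₃(Δ_min) mod 4` -/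

/-- **`f₃ = 4 ⟺ v₃(Δ_min)` is even** on the wild cell at `3` (`m ∈ {1, 3, 7, 9}` is odd, so Ogg's formula gives
`f₃ ≡ v₃(Δ_min) (mod 2)`, and `f₃ ∈ {3, 4, 5}`). [cite: Kraus1990, Théorème (p = 3)] [cite: SilvermanATAEC1994, IV.10.4 and IV.11.1] -/
theorem condExp_eq_four_iff_even (hadd : Addv W 3) (hW : SubW W 3) :
    condExp W 3 = 4 ↔ Even (padicValInt 3 W.minimalDiscriminantInt) := by
  rw [Nat.even_iff]
  rcases kodairaSymbolAt_windows W hadd hW with ⟨-, h1, h2, h3⟩ | ⟨-, h1, h2, h3⟩ | ⟨-, h1, h2, h3⟩ |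
    ⟨-, h1, h2, h3⟩ <;> omega

/-- **`f₃ ∈ {3, 5} ⟺ v₃(Δ_min)` is odd** on the wild cell at `3`. [cite: Kraus1990, Théorème (p = 3)] -/
theorem condExp_eq_three_or_five_iff_odd (hadd : Addv W 3) (hW : SubW W 3) :
    (condExp W 3 = 3 ∨ condExp W 3 = 5) ↔ Odd (padicValInt 3 W.minimalDiscriminantInt) := by
  rw [Nat.odd_iff]
  rcases kodairaSymbolAt_windows W hadd hW with ⟨-, h1, h2, h3⟩ | ⟨-, h1, h2, h3⟩ | ⟨-, h1, h2, h3⟩ |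
    ⟨-, h1, h2, h3⟩ <;> omega

/-- **The E2 dictionary, UNCONDITIONALLY: `f₃ = 4 ⟺` the cyclic Kraus cell** (`SubWCyclic W`: (w) with
`v₃(Δ_min)` even, `Φ ∈ {C₃, C₆}`) — the hypothesis-free form of `O6Targets.condExp_eq_four_iff_subWCyclic`
(there granted an `AdmissibleWildTyping`). Census (EVIDENCE): `v₃(N) = 4` on exactly the 16 982 cyclic rows.
[cite: Kraus1990, Théorème (p = 3)] [cite: SilvermanATAEC1994, IV.10.4 and IV.11.1] -/
theorem condExp_eq_four_iff_subWCyclic (hadd : Addv W 3) (hW : SubW W 3) :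
    condExp W 3 = 4 ↔ SubWCyclic W := by
  rw [condExp_eq_four_iff_even W hadd hW]
  exact ⟨fun h ↦ ⟨hW, h⟩, fun h ↦ h.2⟩

/-- **`f₃ ∈ {3, 5} ⟺` the dicyclic Kraus cell** (`SubWDicyclic W`: (w) with `v₃(Δ_min)` odd, `Φ ≅ C₃ ⋊ C₄`).
Census (EVIDENCE): `v₃(N) ∈ {3, 5}` on exactly the 62 438 dicyclic rows. [cite: Kraus1990, Théorème (p = 3)] -/
theorem condExp_eq_three_or_five_iff_subWDicyclic (hadd : Addv W 3) (hW : SubW W 3) :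
    (condExp W 3 = 3 ∨ condExp W 3 = 5) ↔ SubWDicyclic W := by
  rw [condExp_eq_three_or_five_iff_odd W hadd hW]
  exact ⟨fun h ↦ ⟨hW, h⟩, fun h ↦ h.2⟩

/-- **On the cyclic rows the Kodaira type is determined by `v₃(Δ_min)`**: `v` even ⟹
`(v, K₃) ∈ {(4, II), (6, IV), (10, IV*), (12, II*)}` (the even entries of the Papadopoulos windows).
[cite: Papadopoulos1993, Table (p = 3)] [cite: SilvermanATAEC1994, IV.9.4 and Table 4.1] -/
theorem kodairaSymbolAt_of_even (hadd : Addv W 3) (hW : SubW W 3)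
    (hev : Even (padicValInt 3 W.minimalDiscriminantInt)) :
    (W.kodairaSymbolAt (placeOf 3) = .II ∧ padicValInt 3 W.minimalDiscriminantInt = 4) ∨
      (W.kodairaSymbolAt (placeOf 3) = .IV ∧ padicValInt 3 W.minimalDiscriminantInt = 6) ∨
      (W.kodairaSymbolAt (placeOf 3) = .IVstar ∧ padicValInt 3 W.minimalDiscriminantInt = 10) ∨
      (W.kodairaSymbolAt (placeOf 3) = .IIstar ∧ padicValInt 3 W.minimalDiscriminantInt = 12) := by
  rw [Nat.even_iff] at hev
  rcases kodairaSymbolAt_windows W hadd hW with ⟨hK, h1, h2, -⟩ | ⟨hK, h1, h2, -⟩ | ⟨hK, h1, h2, -⟩ |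
    ⟨hK, h1, h2, -⟩
  · exact Or.inl ⟨hK, by omega⟩
  · exact Or.inr (Or.inl ⟨hK, by omega⟩)
  · exact Or.inr (Or.inr (Or.inl ⟨hK, by omega⟩))
  · exact Or.inr (Or.inr (Or.inr ⟨hK, by omega⟩))

/-- **`v₃(Δ_min) ∈ {4, 6, 10, 12}` on the cyclic rows** (the values taken as HYPOTHESES in
`Additive/LocIrrThreeCriteria.not_locIrr_three_of_cyclic_values`). [cite: Papadopoulos1993, Table (p = 3)] -/
theorem padicValInt_mem_of_even (hadd : Addv W 3) (hW : SubW W 3)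
    (hev : Even (padicValInt 3 W.minimalDiscriminantInt)) :
    padicValInt 3 W.minimalDiscriminantInt = 4 ∨ padicValInt 3 W.minimalDiscriminantInt = 6 ∨
      padicValInt 3 W.minimalDiscriminantInt = 10 ∨ padicValInt 3 W.minimalDiscriminantInt = 12 := by
  rcases kodairaSymbolAt_of_even W hadd hW hev with ⟨-, h⟩ | ⟨-, h⟩ | ⟨-, h⟩ | ⟨-, h⟩
  · exact Or.inl h
  · exact Or.inr (Or.inl h)
  · exact Or.inr (Or.inr (Or.inl h))
  · exact Or.inr (Or.inr (Or.inr h))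

/-- **`4 ∣ v₃(Δ_min)` (inertia `C₃`; the route's untwisting character `η` of order `3`) ⟹ Kodaira `II` with
`v = 4` or `II*` with `v = 12`.** [cite: Kraus1990, Théorème (p = 3)] [cite: Papadopoulos1993, Table (p = 3)] -/
theorem kodairaSymbolAt_of_four_dvd (hadd : Addv W 3) (hW : SubW W 3)
    (h4 : 4 ∣ padicValInt 3 W.minimalDiscriminantInt) :
    (W.kodairaSymbolAt (placeOf 3) = .II ∧ padicValInt 3 W.minimalDiscriminantInt = 4) ∨
      (W.kodairaSymbolAt (placeOf 3) = .IIstar ∧ padicValInt 3 W.minimalDiscriminantInt = 12) := by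
  have hev : Even (padicValInt 3 W.minimalDiscriminantInt) :=
    (Nat.even_iff.mpr (by omega))
  rcases kodairaSymbolAt_of_even W hadd hW hev with h | ⟨-, h⟩ | ⟨-, h⟩ | h
  · exact Or.inl h
  · exact absurd h4 (by rw [h]; decide)
  · exact absurd h4 (by rw [h]; decide)
  · exact Or.inr h

/-- **`v₃(Δ_min) ≡ 2 (mod 4)` (inertia `C₆`; `η` of order `6`) ⟹ Kodaira `IV` with `v = 6` or `IV*` with
`v = 10`.** [cite: Kraus1990, Théorème (p = 3)] [cite: Papadopoulos1993, Table (p = 3)] -/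
theorem kodairaSymbolAt_of_mod_four_eq_two (hadd : Addv W 3) (hW : SubW W 3)
    (h2 : padicValInt 3 W.minimalDiscriminantInt % 4 = 2) :
    (W.kodairaSymbolAt (placeOf 3) = .IV ∧ padicValInt 3 W.minimalDiscriminantInt = 6) ∨
      (W.kodairaSymbolAt (placeOf 3) = .IVstar ∧ padicValInt 3 W.minimalDiscriminantInt = 10) := by
  have hev : Even (padicValInt 3 W.minimalDiscriminantInt) :=
    (Nat.even_iff.mpr (by omega))
  rcases kodairaSymbolAt_of_even W hadd hW hev with ⟨-, h⟩ | h | h | ⟨-, h⟩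
  · omega
  · exact Or.inl h
  · exact Or.inr h
  · omega

/-- **Kodaira `IV` or `IV*` at `3` on the cyclic rows ⟺ `v₃(Δ_min) ≡ 2 (mod 4)`** (in the tree's predicate
`HasKodairaIVOrIVstarAt W 3`). [cite: Papadopoulos1993, Table (p = 3)] -/
theorem hasKodairaIVOrIVstarAt_three_iff_of_even (hadd : Addv W 3) (hW : SubW W 3)
    (hev : Even (padicValInt 3 W.minimalDiscriminantInt)) :
    HasKodairaIVOrIVstarAt W 3 ↔ padicValInt 3 W.minimalDiscriminantInt % 4 = 2 := by
  refine ⟨fun hK ↦ ?_, fun h2 ↦ ?_⟩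
  · rcases kodairaSymbolAt_of_even W hadd hW hev with ⟨h, hv⟩ | ⟨-, hv⟩ | ⟨-, hv⟩ | ⟨h, hv⟩
    · rcases hK with hK | hK <;> rw [hK] at h <;> exact absurd h (by decide)
    · omega
    · omega
    · rcases hK with hK | hK <;> rw [hK] at h <;> exact absurd h (by decide)
  · rcases kodairaSymbolAt_of_mod_four_eq_two W hadd hW h2 with ⟨h, -⟩ | ⟨h, -⟩
    · exact Or.inl h
    · exact Or.inr h

/-- **Kraus's inertia order on the cyclic rows**: `#Φ = 3` when `4 ∣ v₃(Δ_min)` and `#Φ = 6` when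
`v₃(Δ_min) ≡ 2 (mod 4)` (the tree's table-valued `krausInertiaOrderThree`, read on the wild types).
[cite: Kraus1990, Théorème (p = 3)] [cite: Coppola2020, Thm. 2.7] -/
theorem krausInertiaOrderThree_of_even (hadd : Addv W 3) (hW : SubW W 3)
    (hev : Even (padicValInt 3 W.minimalDiscriminantInt)) :
    (4 ∣ padicValInt 3 W.minimalDiscriminantInt → krausInertiaOrderThree W = 3) ∧
      (padicValInt 3 W.minimalDiscriminantInt % 4 = 2 → krausInertiaOrderThree W = 6) := by
  have hT := (subW_three_iff_kodairaSymbolAt_wild W hadd).mp hW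
  have hred : krausInertiaOrderThree W =
      (if padicValInt 3 W.minimalDiscriminantInt % 4 = 0 then 3
       else if padicValInt 3 W.minimalDiscriminantInt % 2 = 0 then 6 else 12) := by
    unfold krausInertiaOrderThree
    rcases hT with h | h | h | h <;> rw [h]
  have h2 : padicValInt 3 W.minimalDiscriminantInt % 2 = 0 := Nat.even_iff.mp hev
  refine ⟨fun h4 ↦ ?_, fun h4 ↦ ?_⟩
  · have h40 : padicValInt 3 W.minimalDiscriminantInt % 4 = 0 := Nat.mod_eq_zero_of_dvd h4
    rw [hred, if_pos h40]
  · have h4' : ¬ padicValInt 3 W.minimalDiscriminantInt % 4 = 0 := by omega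
    rw [hred, if_neg h4', if_pos h2]

/-! ### §3 The local Tamagawa number `c₃` on the cyclic rows -/

/-- The residue field of the completed local ring at the place `(3)` of `ℤ` is perfect (it is finite).
[folklore] -/
private theorem perfectField_residueField_placeOf_three :
    PerfectField (IsLocalRing.ResidueField ((placeOf 3).adicCompletionIntegers ℚ)) :=
  PerfectField.ofFinite

/-- **`4 ∣ v₃(Δ_min)` on the wild cell ⟹ `c₃ = 1`** (Kodaira II/II*, Tate's algorithm Steps 3 and 10: `c = 1`;
tree facts `localTamagawaNumber_eq_one_of_kodairaSymbolAt_eq_II(_star)_holds`, read over `ℤ₃ ⊆ ℚ₃` by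
`localTamagawaNumber_padic_eq_placeOf`). On the route's `η`-order-`3` principal-series rows there is NO
Tamagawa factor `3` at the prime `3`. [cite: SilvermanATAEC1994, IV.9.4 Steps 3 and 10 (PDF pp. 344, 346)] -/
theorem localTamagawaNumber_three_eq_one_of_four_dvd (hadd : Addv W 3) (hW : SubW W 3)
    (h4 : 4 ∣ padicValInt 3 W.minimalDiscriminantInt) :
    (W.baseChange ℚ_[3]).localTamagawaNumber ℤ_[3] = 1 := by
  haveI := perfectField_residueField_placeOf_three
  rw [localTamagawaNumber_padic_eq_placeOf W 3]
  rcases kodairaSymbolAt_of_four_dvd W hadd hW h4 with ⟨hK, -⟩ | ⟨hK, -⟩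
  · exact localTamagawaNumber_eq_one_of_kodairaSymbolAt_eq_II_holds (placeOf 3) W hK
  · exact localTamagawaNumber_eq_one_of_kodairaSymbolAt_eq_IIstar_holds (placeOf 3) W hK

/-- **`v₃(Δ_min) ≡ 2 (mod 4)` on the wild cell ⟹ `c₃ ∈ {1, 3}`** (Kodaira IV/IV*, Tate's algorithm Steps 5 and
8: `c = 3` iff the auxiliary quadratic splits over `𝔽₃`; tree facts `…_eq_IV(_star)_holds` through
`localTamagawaNumber_padic_eq_one_or_three_of_hasKodairaIVOrIVstarAt`).
[cite: SilvermanATAEC1994, IV.9.4 Steps 5 and 8 (PDF pp. 344, 346)] -/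
theorem localTamagawaNumber_three_of_mod_four_eq_two (hadd : Addv W 3) (hW : SubW W 3)
    (h2 : padicValInt 3 W.minimalDiscriminantInt % 4 = 2) :
    (W.baseChange ℚ_[3]).localTamagawaNumber ℤ_[3] = 1 ∨
      (W.baseChange ℚ_[3]).localTamagawaNumber ℤ_[3] = 3 :=
  localTamagawaNumber_padic_eq_one_or_three_of_hasKodairaIVOrIVstarAt W 3
    ((hasKodairaIVOrIVstarAt_three_iff_of_even W hadd hW (Nat.even_iff.mpr (by omega))).mpr h2)

/-- **`v₃(Δ_min)` even on the wild cell ⟹ `c₃ ∈ {1, 3}`** (all four cyclic types II, IV, IV*, II*).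
[cite: SilvermanATAEC1994, IV.9.4 Steps 3, 5, 8, 10 and Table 4.1] -/
theorem localTamagawaNumber_three_of_even (hadd : Addv W 3) (hW : SubW W 3)
    (hev : Even (padicValInt 3 W.minimalDiscriminantInt)) :
    (W.baseChange ℚ_[3]).localTamagawaNumber ℤ_[3] = 1 ∨
      (W.baseChange ℚ_[3]).localTamagawaNumber ℤ_[3] = 3 := by
  have h2 : padicValInt 3 W.minimalDiscriminantInt % 2 = 0 := Nat.even_iff.mp hev
  by_cases h4 : padicValInt 3 W.minimalDiscriminantInt % 4 = 0
  · exact Or.inl (localTamagawaNumber_three_eq_one_of_four_dvd W hadd hW (Nat.dvd_of_mod_eq_zero h4))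
  · exact localTamagawaNumber_three_of_mod_four_eq_two W hadd hW (by omega)

/-- **`ord₃ c₃ ≤ 1` on the cyclic rows** (`c₃ ∈ {1, 3}`). [cite: SilvermanATAEC1994, IV.9.4 and Table 4.1] -/
theorem padicValNat_localTamagawaNumber_three_le_one_of_even (hadd : Addv W 3) (hW : SubW W 3)
    (hev : Even (padicValInt 3 W.minimalDiscriminantInt)) :
    padicValNat 3 ((W.baseChange ℚ_[3]).localTamagawaNumber ℤ_[3]) ≤ 1 := by
  rcases localTamagawaNumber_three_of_even W hadd hW hev with h | h <;> rw [h]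
  · simp
  · rw [padicValNat.self (by norm_num)]

/-- **`ord₃ c₃ = 0` on the `η`-order-`3` rows** (`4 ∣ v₃(Δ_min)`). [cite: SilvermanATAEC1994, IV.9.4 Steps 3 and 10] -/
theorem padicValNat_localTamagawaNumber_three_eq_zero_of_four_dvd (hadd : Addv W 3) (hW : SubW W 3)
    (h4 : 4 ∣ padicValInt 3 W.minimalDiscriminantInt) :
    padicValNat 3 ((W.baseChange ℚ_[3]).localTamagawaNumber ℤ_[3]) = 0 := by
  rw [localTamagawaNumber_three_eq_one_of_four_dvd W hadd hW h4]
  simp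

/-- **A Tamagawa factor `3` at the prime `3` forces the `η`-order-`6` rows**: on the cyclic wild cell,
`3 ∣ c₃ ⟹ v₃(Δ_min) ≡ 2 (mod 4)` and the Kodaira type is `IV` or `IV*` — K2's «`c₃ = 3` on IV/IV* rows»
obstruction is CONFINED to `v₃(Δ_min) ∈ {6, 10}`. [cite: SilvermanATAEC1994, IV.9.4 and Table 4.1] -/
theorem mod_four_eq_two_of_three_dvd_localTamagawaNumber (hadd : Addv W 3) (hW : SubW W 3)
    (hev : Even (padicValInt 3 W.minimalDiscriminantInt))
    (h3 : 3 ∣ (W.baseChange ℚ_[3]).localTamagawaNumber ℤ_[3]) :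
    padicValInt 3 W.minimalDiscriminantInt % 4 = 2 ∧ HasKodairaIVOrIVstarAt W 3 := by
  have h2 : padicValInt 3 W.minimalDiscriminantInt % 2 = 0 := Nat.even_iff.mp hev
  by_cases h4 : padicValInt 3 W.minimalDiscriminantInt % 4 = 0
  · rw [localTamagawaNumber_three_eq_one_of_four_dvd W hadd hW (Nat.dvd_of_mod_eq_zero h4)] at h3
    exact absurd h3 (by decide)
  · have h42 : padicValInt 3 W.minimalDiscriminantInt % 4 = 2 := by omega
    exact ⟨h42, (hasKodairaIVOrIVstarAt_three_iff_of_even W hadd hW hev).mpr h42⟩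

/-! ### §4 (L3) fails on every cyclic wild row: `E[3]|G_{ℚ₃}` is reducible -/

/-- **`v₃(Δ_min)` even on the wild cell ⟹ `¬ LocIrr W 3`** (`E[3]` is a REDUCIBLE `G_{ℚ₃}`-module): §2 gives
`f₃ = 4`, and the tree theorem `not_locIrr_three_of_condExp_eq_four` (L-O56-sel `locIrrThreeIffCriterion_holds`
+ the wild signature theorem: `LocIrr(3)` on the wild locus forces `f₃ = 3`) concludes.
[cite: FouquetWan2021, Thm 1.7 (hypothesis on ρ̄|G_{ℚ_p})] [cite: SilvermanATAEC1994, IV.9.4] -/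
theorem not_locIrr_three_of_even (hadd : Addv W 3) (hW : SubW W 3)
    (hev : Even (padicValInt 3 W.minimalDiscriminantInt)) : ¬ LocIrr W 3 :=
  not_locIrr_three_of_condExp_eq_four W ((condExp_eq_four_iff_even W hadd hW).mpr hev)

/-- **The cyclic Kraus cell never meets the Fouquet–Wan locus: `SubWCyclic W → ¬ LocIrr W 3`** — o6-r1's
wanted implication (census `LocIrr(3) = 0 / 5 161` on the cyclic cell, `Additive/LocIrrThreeCriteria.lean`),
UNCONDITIONALLY and with NO census column as hypothesis. [cite: FouquetWan2021, Thm 1.7] [cite: Kraus1990, Théorème (p = 3)] -/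
theorem not_locIrr_three_of_subWCyclic (hadd : Addv W 3) (hc : SubWCyclic W) : ¬ LocIrr W 3 :=
  not_locIrr_three_of_even W hadd hc.1 hc.2

/-- The same in Mathlib-facing currency: on the cyclic wild cell `E[3] ⊗ ℚ₃` is NOT an irreducible
`G_{ℚ₃}`-module (`LocIrr W 3` unfolds to `(W.baseChange ℚ_[3]).HasIrreducibleModPGaloisRep 3`). [cite: FouquetWan2021, Thm 1.7] -/
theorem not_hasIrreducibleModPGaloisRep_three_of_subWCyclic (hadd : Addv W 3) (hc : SubWCyclic W) :
    ¬ (W.baseChange ℚ_[3]).HasIrreducibleModPGaloisRep 3 :=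
  not_locIrr_three_of_subWCyclic W hadd hc

/-- **On the wild cell, `LocIrr W 3` forces the DICYCLIC cell** (`v₃(Δ_min)` odd; indeed `f₃ = 3`, Kodaira II
`(2,4,3)` or IV* `(4,7,9)` by the tree's signature theorem). [cite: FouquetWan2021, Thm 1.7] [cite: Kraus1990, Théorème (p = 3)] -/
theorem subWDicyclic_of_locIrr_three (hadd : Addv W 3) (hW : SubW W 3) (hL : LocIrr W 3) : SubWDicyclic W := by
  rcases (subW_three_iff_cyclic_or_dicyclic W).mp hW with hc | hd
  · exact absurd hL (not_locIrr_three_of_subWCyclic W hadd hc)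
  · exact hd

/-! ### §5 The principal-series rows of route `CyclotomicUntwist` (`ClassO6 W 3`, `v₃(Δ_min)` even) -/

/-- **Local facts at `3` on every principal-series row of the route** (`ClassO6 W 3` — `3 ≠ 2`, additive,
`ord₃ j ≥ 0`, `f₃ ≠ 2` — with `v₃(Δ_min)` even; the unit-part condition `Δ_min/3^v ≡ 1 (mod 3)` and the global
hypotheses `¬ CM`, `Surj W 3`, `r_an = 1` of K1/K2 are not needed): `f₃ = 4` (so `81 ∥ N` and the untwist has
level `9·(N/81)`), `E[3]|G_{ℚ₃}` reducible (FW21 Thm 1.7 inapplicable), `c₃ ∈ {1, 3}`, and `c₃ = 1` whenever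
`4 ∣ v₃(Δ_min)`. [cite: SilvermanATAEC1994, IV.9.4, IV.10.4] [cite: FouquetWan2021, Thm 1.7] -/
theorem psRow_facts (hO6 : ClassO6 W 3) (hev : Even (padicValInt 3 W.minimalDiscriminantInt)) :
    condExp W 3 = 4 ∧ ¬ LocIrr W 3 ∧
      ((W.baseChange ℚ_[3]).localTamagawaNumber ℤ_[3] = 1 ∨ (W.baseChange ℚ_[3]).localTamagawaNumber ℤ_[3] = 3) ∧
      (4 ∣ padicValInt 3 W.minimalDiscriminantInt → (W.baseChange ℚ_[3]).localTamagawaNumber ℤ_[3] = 1) := by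
  obtain ⟨-, hadd, hW⟩ := hO6
  exact ⟨(condExp_eq_four_iff_even W hadd hW).mpr hev, not_locIrr_three_of_even W hadd hW hev,
    localTamagawaNumber_three_of_even W hadd hW hev,
    fun h4 ↦ localTamagawaNumber_three_eq_one_of_four_dvd W hadd hW h4⟩

/-- **The principal-series rows lie in the cyclic Kraus cell with `f₃ = 4`**, in the binder shape of the route
items K1/K2 (`∀ W, ¬ CM → ClassO6 W 3 → Surj W 3 → v even → unit ≡ 1 (mod 3) → …`; the unused binders are
kept so that a line can `have` this verbatim). [cite: Kraus1990, Théorème (p = 3)] [cite: SilvermanATAEC1994, IV.10.4] -/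
theorem psRows_condExp_eq_four_and_not_locIrr :
    ∀ (W : WeierstrassCurve ℚ) [W.IsElliptic] [W.IsGloballyMinimal],
      ¬ W.HasCM → ClassO6 W 3 → Surj W 3 → Even (padicValInt 3 W.minimalDiscriminantInt) →
      W.minimalDiscriminantInt / 3 ^ padicValInt 3 W.minimalDiscriminantInt % 3 = 1 →
      SubWCyclic W ∧ condExp W 3 = 4 ∧ ¬ LocIrr W 3 ∧
        padicValNat 3 ((W.baseChange ℚ_[3]).localTamagawaNumber ℤ_[3]) ≤ 1 := by
  intro W _ _ _ hO6 _ hev _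
  obtain ⟨-, hadd, hW⟩ := hO6
  exact ⟨⟨hW, hev⟩, (condExp_eq_four_iff_even W hadd hW).mpr hev, not_locIrr_three_of_even W hadd hW hev,
    padicValNat_localTamagawaNumber_three_le_one_of_even W hadd hW hev⟩

end Summit.BirchSwinnertonDyer.BirchSwinnertonDyer.Theorems.PSKodairaDictionary

end
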